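/-
Copyright (c) 2026. All rights reserved.
Released under Apache 2.0 license as described in the file LICENSE.
-/
import Summits.HodgeConjecture.HodgeConjecture.Theorems.K2LiuHolTubeRigidityOfFrame       -- ★ Hol-2b file 1: `frame_mul`, `eq_of_frame_conj_eq`, the by-value frame binders
import Summits.HodgeConjecture.HodgeConjecture.Theorems.K2LiuArchInducedTubeDefs           -- ★ (D∞) `hermOfReal`
import Summits.HodgeConjecture.HodgeConjecture.Theorems.K2LiuArchUnipotentHaarTransport    -- ★ asm FILE 11 `exists_integral_comp_eq_smul`
import HarnessLib

/-!
# Crux `HLiu418`, G6-arch ASSEMBLY FILE 12 — (E8) RECORD BOOKKEEPING: FRAME COORDINATES ON `N_Δ(L⁺ ⊗ ℝ)`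
# `Φ : N_Δ(L⁺ ⊗ ℝ) ≃ₜ ∏_w ℝ^{n×n}` with `Φ(uv) = Φ u + Φ v` and `Fr_w(u) = n(hermOfReal (Φ u w))`, and the Haar transport
# `∫_{N_Δ(L⁺⊗ℝ)} Ψ(Fr u) dν(u) = c · ∫_{∏_w ℝ^{n×n}} Ψ((n(hermOfReal r_w))_w) dr` for EVERY Haar-type `ν` and EVERY `Ψ`

Cell `hodgecm-mathlib`, crux item hLiu418 = `stmt-HodgeConjecture-24832` (helper lane `--supports`, count-neutral).  LEAD BATCH #53 (2) ∕ #56: «(E8) record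
`exists_frameCoordinates`, then the (E8) END lemma → K2Liu-p11»; K2Liu-p13 (g4) desk 16:40:35Z «∀-Haar form preferred».

THE FRAME OF RECORD (all ★, BY VALUE as in ★ `K2LiuHolTubeRigidityOfFrame` §2): per complex place `w` one tube frame `(T_w, T_w⁻¹)` (★ `exists_tubeFrame_arch₂∕₃∕₄`
clauses as hypotheses), `Fr a w = T_w · (a_w)~ · T_w⁻¹` (`hFr`).  Clause (iv) `hTiv`: a unipotent `u_w ∈ U(J^𝔻)(L_w)` is framed to a hermitian translation
`n(b) = (1 b; 0 1)`; clause (iv′) `hTN`: every hermitian translation is so reached.  With ★ `mem_unipDeltaArch_iff_forall_archAt` (`u ∈ N_Δ(L⁺⊗ℝ) ↔ ∀ w, IsUnipM u_w`),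
★ `archPiEquiv` (`H_∞ ≃ₜ* ∏_w H_w`) and the real chart ★ `hermOfReal : ℝ^{n×n} ≅ Herm_n(ℂ)` this gives:
* §1 the explicit inverse chart `b ↦ ((Re b_{ij} + Im b_{ij})∕2)_{ij}` of `hermOfReal` (`re_add_im_hermOfReal_div_two`, `hermOfReal_re_add_im_div_two`), `continuous_hermOfReal`
  (generic size), `reindex_reindex_symm ∕ reindex_symm_reindex'`;
* §2 the local letters: `eq_conj_of_frame_conj_eq` (`T X T⁻¹ = Y ⇒ X = T⁻¹ Y T`), `transl_loc_val_mul_inv ∕ _inv_mul_val` (the explicit unit `(T_w⁻¹ n(b) T_w)~`),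
  `exists_archLocal_coe_eq_transl_loc` ((iv′) + frame injectivity: that explicit matrix IS an `IsUnipM` element of `U(J^𝔻)(L_w)`), `frame_coe_eq_transl`
  (`Fr u w = n(hermOfReal (coordinates))` for `u ∈ N_Δ(L⁺⊗ℝ)`);
* §3 **`exists_frameCoordinates`**: `∃ Φ : N_Δ(L⁺⊗ℝ) ≃ₜ ({w ∣ complex} → ℝ^{n×n})`, `Φ(uv) = Φ u + Φ v`, `Fr u w = n(hermOfReal (Φ u w))`;
* §4 **`exists_integral_frame_eq_smul`** (+ ★ FILE 11): for `ν` left-invariant and finite on compacts on `N_Δ(L⁺⊗ℝ)` there is ONE `c : ℝ≥0` with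
  `∫ Ψ(Fr u) dν(u) = c • ∫ Ψ((n(hermOfReal r_w))_w) dr` for every `Ψ : (∏_w M_{2n}(ℂ)) → F`; and **`exists_integral_frame_conj_eq_smul`**, the same for
  `u ↦ Ψ(Fr (x u g))` = `Ψ((Fr x w · n(hermOfReal r_w) · Fr g w)_w)` (★ `frame_mul`) — the shape of the arch block `∫ f((w_Δ)_∞ u h_∞) dν_∞(u)` of ★ (E3).
WHAT REMAINS for the (E8) END letter `hA` after this file: the presentation of the integrand as (a finite sum of) products over the complex places of tube-side
sections with fixed compact pictures (then ★ FILE 10 `archBlock_prod_continuation` applies verbatim at `n = 2`).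
References: [BorelJacquet1979, §4.1]; [Shimura1997, §§5–6]; [Folland1995, §2.2].
HONEST LABEL: HC_CM is proved only modulo the 7 printed citations (2 remaining named inputs: hLiu418 = stmt-HodgeConjecture-24832,
h413 = stmt-HodgeConjecture-24833) until rung 0 closes; count-neutral helper, closes no socket.
-/

set_option autoImplicit false
set_option linter.dupNamespace false

noncomputable section

open Matrix Complex MeasureTheory
open scoped MatrixGroups NNReal
open NumberField NumberField.InfinitePlace
open Literature.NumberTheory.Automorphic Literature.NumberTheory.Automorphic.UnitaryGroup
open Literature.NumberTheory.GelbartRogawski1991 Literature.NumberTheory.GelbartRogawski1991.GRConstruction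
open Literature.NumberTheory.K2Lit.SiegelDoubled

namespace Summit.HodgeConjecture.HodgeConjecture.Cruxes.HLiu418.K2LiuArchUnipotentFrameCoordinates

open K2LiuHermitianTubeCocycle K2LiuSiegelUnipotentLocalDefs K2LiuSiegelUnipotentArchPlaces K2LiuHolTubeRigidityOfFrame K2LiuArchInducedTubeDefs
open K2LiuArchUnipotentHaarTransport (exists_integral_comp_eq_smul)

/-! ## §1  The real chart of the hermitian matrices: explicit inverse and continuity -/

section Chart

variable {l : Type*}

/-- the explicit inverse chart: `(Re (hermOfReal r)_{ij} + Im (hermOfReal r)_{ij}) ∕ 2 = r_{ij}`. [Shimura1997, §5.6] -/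
theorem re_add_im_hermOfReal_div_two [Fintype l] [DecidableEq l] (r : l → l → ℝ) (i j : l) :
    ((hermOfReal r i j).re + (hermOfReal r i j).im) / 2 = r i j := by
  rw [hermOfReal_apply]
  simp only [Complex.add_re, Complex.add_im, Complex.ofReal_re, Complex.ofReal_im, Complex.mul_re, Complex.mul_im, Complex.I_re, Complex.I_im]
  ring

/-- a hermitian `b` is `hermOfReal` of its explicit coordinates `((Re b_{ij} + Im b_{ij}) ∕ 2)_{ij}`. [Shimura1997, §5.6] -/
theorem hermOfReal_re_add_im_div_two [Fintype l] [DecidableEq l] {b : Matrix l l ℂ} (hb : bᴴ = b) :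
    hermOfReal (fun i j => ((b i j).re + (b i j).im) / 2) = b := by
  obtain ⟨r, rfl⟩ := exists_hermOfReal_eq hb
  congr 1
  funext i j
  exact re_add_im_hermOfReal_div_two r i j

/-- `hermOfReal` is continuous (any size). [folklore] -/
theorem continuous_hermOfReal [Fintype l] [DecidableEq l] : Continuous (hermOfReal (l := l)) := by
  refine continuous_matrix fun i j => ?_
  simp only [hermOfReal_apply]
  exact ((continuous_ofReal.comp ((continuous_apply_apply i j).add (continuous_apply_apply j i))).add
    ((continuous_ofReal.comp ((continuous_apply_apply i j).sub (continuous_apply_apply j i))).mul continuous_const))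

/-- `reindex f f (reindex f⁻¹ f⁻¹ X) = X`. [folklore] -/
theorem reindex_reindex_symm {m k : Type*} {R : Type*} (f : m ≃ k) (X : Matrix k k R) :
    Matrix.reindex f f (Matrix.reindex f.symm f.symm X) = X := by
  rw [reindex_apply, reindex_apply, submatrix_submatrix, Equiv.symm_symm, Equiv.self_comp_symm, submatrix_id_id]

/-- `reindex f⁻¹ f⁻¹ (reindex f f X) = X`. [folklore] -/
theorem reindex_symm_reindex' {m k : Type*} {R : Type*} (f : m ≃ k) (X : Matrix m m R) :
    Matrix.reindex f.symm f.symm (Matrix.reindex f f X) = X := by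
  rw [reindex_apply, reindex_apply, submatrix_submatrix, Equiv.symm_symm, Equiv.symm_comp_self, submatrix_id_id]

end Chart

/-! ## §2  The local letters of the frame on `N_Δ` -/

section Adelic

variable (L : Type) [Field L] [NumberField L] [IsCMField L] {N M n : ℕ} (e : Fin N × Fin M ≃ Fin n)
  (dV : Fin N → L) (hdV : ∀ i, IsCMField.complexConj L (dV i) = dV i)
  (dW : Fin M → L) (hdW : ∀ i, IsCMField.complexConj L (dW i) = dW i)
  (T Tinv : {w : InfinitePlace L // w.IsComplex} → Matrix (Fin n ⊕ Fin n) (Fin n ⊕ Fin n) ℂ)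
  (Fr : UnitaryGroup.arch (Fp L) L (IsCMField.complexConj L) (n + n) (hermD L e dV hdV dW hdW) →
    {w : InfinitePlace L // w.IsComplex} → Matrix (Fin n ⊕ Fin n) (Fin n ⊕ Fin n) ℂ)
  (hFr : ∀ a w, Fr a w = T w * Matrix.reindex (e₂ (n := n)).symm (e₂ (n := n)).symm
    (((UnitaryGroup.archAt (Fp L) L (IsCMField.complexConj L) (n + n) (hermD L e dV hdV dW hdW) w
      (UnitaryGroup.complexConj_smul_infinitePlace L w.1) (IsCMField.complexConj_ne_one L) a :
        UnitaryGroup.archLocal L (n + n) (hermD L e dV hdV dW hdW) w) : GL (Fin (n + n)) ℂ) : Matrix (Fin (n + n)) (Fin (n + n)) ℂ) * Tinv w)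
  (hT1 : ∀ w, T w * Tinv w = 1) (hT2 : ∀ w, Tinv w * T w = 1)
  (hTiv : ∀ w (u : GL (Fin (n + n)) ℂ), u ∈ UnitaryGroup.archLocal L (n + n) (hermD L e dV hdV dW hdW) w →
    IsUnipM (n := n) (u : Matrix (Fin (n + n)) (Fin (n + n)) ℂ) →
      ∃ b : Matrix (Fin n) (Fin n) ℂ, bᴴ = b ∧ T w * Matrix.reindex (e₂ (n := n)).symm (e₂ (n := n)).symm (u : Matrix _ _ ℂ) * Tinv w = fromBlocks 1 b 0 1)
  (hTN : ∀ w (b : Matrix (Fin n) (Fin n) ℂ), bᴴ = b → ∃ u : GL (Fin (n + n)) ℂ,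
    u ∈ UnitaryGroup.archLocal L (n + n) (hermD L e dV hdV dW hdW) w ∧ IsUnipM (n := n) (u : Matrix (Fin (n + n)) (Fin (n + n)) ℂ) ∧
      T w * Matrix.reindex (e₂ (n := n)).symm (e₂ (n := n)).symm (u : Matrix _ _ ℂ) * Tinv w = fromBlocks 1 b 0 1)

omit [NumberField L] in
include hT2 in
/-- frame conjugation solved for the middle factor: `T X T⁻¹ = Y ⇒ X = T⁻¹ Y T`. [folklore] -/
theorem eq_conj_of_frame_conj_eq (w : {w : InfinitePlace L // w.IsComplex}) {X Y : Matrix (Fin n ⊕ Fin n) (Fin n ⊕ Fin n) ℂ}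
    (h : T w * X * Tinv w = Y) : X = Tinv w * Y * T w := by
  rw [← h, show Tinv w * (T w * X * Tinv w) * T w = (Tinv w * T w) * X * (Tinv w * T w) by simp only [Matrix.mul_assoc], hT2,
    Matrix.one_mul, Matrix.mul_one]

omit [NumberField L] in
include hT1 hT2 in
/-- the explicit local unit: `(T⁻¹ n(b) T)~ · (T⁻¹ n(−b) T)~ = 1` (`n(b) n(−b) = 1`, `T T⁻¹ = 1 = T⁻¹ T`). [Shimura1997, §6.4] -/
theorem transl_loc_val_mul_inv (w : {w : InfinitePlace L // w.IsComplex}) (b : Matrix (Fin n) (Fin n) ℂ) :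
    Matrix.reindex (e₂ (n := n)) (e₂ (n := n)) (Tinv w * fromBlocks 1 b 0 1 * T w) *
      Matrix.reindex (e₂ (n := n)) (e₂ (n := n)) (Tinv w * fromBlocks 1 (-b) 0 1 * T w) = 1 := by
  rw [reindex_apply, reindex_apply, submatrix_mul_equiv,
    show Tinv w * fromBlocks 1 b 0 1 * T w * (Tinv w * fromBlocks 1 (-b) 0 1 * T w) =
      Tinv w * (fromBlocks 1 b 0 1 * (T w * Tinv w) * fromBlocks 1 (-b) 0 1) * T w by simp only [Matrix.mul_assoc],
    hT1, Matrix.mul_one, transl_mul_transl, add_neg_cancel, fromBlocks_one, Matrix.mul_one, hT2, submatrix_one_equiv]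

omit [NumberField L] in
include hT1 hT2 in
/-- the explicit local unit, other order: `(T⁻¹ n(−b) T)~ · (T⁻¹ n(b) T)~ = 1`. [Shimura1997, §6.4] -/
theorem transl_loc_inv_mul_val (w : {w : InfinitePlace L // w.IsComplex}) (b : Matrix (Fin n) (Fin n) ℂ) :
    Matrix.reindex (e₂ (n := n)) (e₂ (n := n)) (Tinv w * fromBlocks 1 (-b) 0 1 * T w) *
      Matrix.reindex (e₂ (n := n)) (e₂ (n := n)) (Tinv w * fromBlocks 1 b 0 1 * T w) = 1 := by
  have h := transl_loc_val_mul_inv L T Tinv hT1 hT2 w (-b)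
  rwa [neg_neg] at h

include hT1 hT2 hTN in
/-- **clause (iv′) read on the explicit matrix**: for hermitian `b`, the matrix `(T_w⁻¹ n(b) T_w)~` IS (the matrix of) an `IsUnipM` element of `U(J^𝔻)(L_w)`
(frame injectivity ★ `eq_of_frame_conj_eq`). [Shimura1997, §§5–6] [BorelJacquet1979, §4.1] -/
theorem exists_archLocal_coe_eq_transl_loc (w : {w : InfinitePlace L // w.IsComplex}) {b : Matrix (Fin n) (Fin n) ℂ} (hb : bᴴ = b) :
    ∃ u : GL (Fin (n + n)) ℂ, u ∈ UnitaryGroup.archLocal L (n + n) (hermD L e dV hdV dW hdW) w ∧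
      IsUnipM (n := n) (u : Matrix (Fin (n + n)) (Fin (n + n)) ℂ) ∧
        (u : Matrix (Fin (n + n)) (Fin (n + n)) ℂ) = Matrix.reindex (e₂ (n := n)) (e₂ (n := n)) (Tinv w * fromBlocks 1 b 0 1 * T w) := by
  obtain ⟨u, hu, hU, hTu⟩ := hTN w b hb
  refine ⟨u, hu, hU, ?_⟩
  have key : T w * Matrix.reindex (e₂ (n := n)).symm (e₂ (n := n)).symm (u : Matrix _ _ ℂ) * Tinv w =
      T w * (Tinv w * fromBlocks 1 b 0 1 * T w) * Tinv w := by
    rw [hTu, show T w * (Tinv w * fromBlocks 1 b 0 1 * T w) * Tinv w = (T w * Tinv w) * fromBlocks 1 b 0 1 * (T w * Tinv w) by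
      simp only [Matrix.mul_assoc], hT1, Matrix.one_mul, Matrix.mul_one]
  have h := eq_of_frame_conj_eq L T Tinv (hT2 w) key
  rw [← reindex_reindex_symm (e₂ (n := n)) (u : Matrix (Fin (n + n)) (Fin (n + n)) ℂ), h]

include hFr hTiv in
/-- **the frame of a unipotent element is the hermitian translation by `hermOfReal` of its explicit coordinates**:
for `u ∈ N_Δ(L⁺ ⊗ ℝ)`, `Fr u w = n(hermOfReal ((Re + Im)∕2 of the upper-right block of Fr u w))` (★ `mem_unipDeltaArch_iff_forall_archAt`, clause (iv)).
[BorelJacquet1979, §4.1] [Shimura1997, §§5–6] -/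
theorem frame_coe_eq_transl (u : ↥(unipDeltaArch L e dV hdV dW hdW)) (w : {w : InfinitePlace L // w.IsComplex}) :
    Fr (u : UnitaryGroup.arch (Fp L) L (IsCMField.complexConj L) (n + n) (hermD L e dV hdV dW hdW)) w =
      fromBlocks 1 (hermOfReal fun i j =>
        (((Fr (u : UnitaryGroup.arch (Fp L) L (IsCMField.complexConj L) (n + n) (hermD L e dV hdV dW hdW)) w (Sum.inl i) (Sum.inr j)).re +
          (Fr (u : UnitaryGroup.arch (Fp L) L (IsCMField.complexConj L) (n + n) (hermD L e dV hdV dW hdW)) w (Sum.inl i) (Sum.inr j)).im) / 2)) 0 1 := by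
  have hu := (mem_unipDeltaArch_iff_forall_archAt L e dV hdV dW hdW
    (u : UnitaryGroup.arch (Fp L) L (IsCMField.complexConj L) (n + n) (hermD L e dV hdV dW hdW))).1 u.2 w
  obtain ⟨b, hb, hFb⟩ := hTiv w _ (UnitaryGroup.archAt (Fp L) L (IsCMField.complexConj L) (n + n) (hermD L e dV hdV dW hdW) w
    (UnitaryGroup.complexConj_smul_infinitePlace L w.1) (IsCMField.complexConj_ne_one L)
      (u : UnitaryGroup.arch (Fp L) L (IsCMField.complexConj L) (n + n) (hermD L e dV hdV dW hdW))).2 hu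
  rw [← hFr] at hFb
  rw [hFb]
  simp only [fromBlocks_apply₁₂]
  rw [hermOfReal_re_add_im_div_two hb]

/-! ## §3  Frame coordinates on `N_Δ(L⁺ ⊗ ℝ)` -/

include hFr hT1 hT2 hTiv hTN in
/-- **(E8) RECORD BOOKKEEPING — FRAME COORDINATES ON `N_Δ(L⁺ ⊗ ℝ)`.**  Under the by-value tube frames of record there is a homeomorphism
`Φ : N_Δ(L⁺ ⊗ ℝ) ≃ₜ ({w ∣ complex} → ℝ^{n×n})` turning products into sums (`Φ(uv) = Φ u + Φ v`) through which every frame component of a unipotent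
element is the hermitian translation `Fr u w = n(hermOfReal (Φ u w))`.  (`Φ u w` = the explicit coordinates of the upper-right block of `Fr u w`; `Φ⁻¹ r` = ★ `archPiEquiv⁻¹`
of the explicit units `(T_w⁻¹ n(hermOfReal r_w) T_w)~`; continuity from ★ `continuous_archAt`, `continuous_hermOfReal`, `Units.continuous_iff`.)
[BorelJacquet1979, §4.1] [Shimura1997, §§5–6] -/
theorem exists_frameCoordinates :
    ∃ Φ : ↥(unipDeltaArch L e dV hdV dW hdW) ≃ₜ ({w : InfinitePlace L // w.IsComplex} → (Fin n → Fin n → ℝ)),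
      (∀ u v, Φ (u * v) = Φ u + Φ v) ∧
      ∀ (u : ↥(unipDeltaArch L e dV hdV dW hdW)) (w : {w : InfinitePlace L // w.IsComplex}),
        Fr (u : UnitaryGroup.arch (Fp L) L (IsCMField.complexConj L) (n + n) (hermD L e dV hdV dW hdW)) w = fromBlocks 1 (hermOfReal (Φ u w)) 0 1 := by
  -- the coordinates `φ` (kept opaque) and the frame identity
  obtain ⟨φ, hφdef⟩ : ∃ φ : ↥(unipDeltaArch L e dV hdV dW hdW) → {w : InfinitePlace L // w.IsComplex} → (Fin n → Fin n → ℝ),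
      φ = fun (u : ↥(unipDeltaArch L e dV hdV dW hdW)) (w : {w : InfinitePlace L // w.IsComplex}) (i j : Fin n) =>
        ((Fr (u : UnitaryGroup.arch (Fp L) L (IsCMField.complexConj L) (n + n) (hermD L e dV hdV dW hdW)) w (Sum.inl i) (Sum.inr j)).re +
          (Fr (u : UnitaryGroup.arch (Fp L) L (IsCMField.complexConj L) (n + n) (hermD L e dV hdV dW hdW)) w (Sum.inl i) (Sum.inr j)).im) / 2 :=
    ⟨_, rfl⟩
  have hφ : ∀ (u : ↥(unipDeltaArch L e dV hdV dW hdW)) (w : {w : InfinitePlace L // w.IsComplex}),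
      Fr (u : UnitaryGroup.arch (Fp L) L (IsCMField.complexConj L) (n + n) (hermD L e dV hdV dW hdW)) w = fromBlocks 1 (hermOfReal (φ u w)) 0 1 := by
    intro u w
    rw [hφdef]
    exact frame_coe_eq_transl L e dV hdV dW hdW T Tinv Fr hFr hTiv u w
  -- the explicit local units `U w ρ = (T_w⁻¹ n(hermOfReal ρ) T_w)~` (kept opaque, with their two defining equations)
  obtain ⟨U, hUval, hUinv⟩ : ∃ U : {w : InfinitePlace L // w.IsComplex} → (Fin n → Fin n → ℝ) → GL (Fin (n + n)) ℂ,
      (∀ w ρ, ((U w ρ : GL (Fin (n + n)) ℂ) : Matrix (Fin (n + n)) (Fin (n + n)) ℂ) =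
        Matrix.reindex (e₂ (n := n)) (e₂ (n := n)) (Tinv w * fromBlocks 1 (hermOfReal ρ) 0 1 * T w)) ∧
      (∀ w ρ, (((U w ρ)⁻¹ : GL (Fin (n + n)) ℂ) : Matrix (Fin (n + n)) (Fin (n + n)) ℂ) =
        Matrix.reindex (e₂ (n := n)) (e₂ (n := n)) (Tinv w * fromBlocks 1 (-hermOfReal ρ) 0 1 * T w)) :=
    ⟨fun w ρ => ⟨_, _, transl_loc_val_mul_inv L T Tinv hT1 hT2 w (hermOfReal ρ), transl_loc_inv_mul_val L T Tinv hT1 hT2 w (hermOfReal ρ)⟩,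
      fun _ _ => rfl, fun _ _ => rfl⟩
  have hUmem : ∀ w ρ, U w ρ ∈ UnitaryGroup.archLocal L (n + n) (hermD L e dV hdV dW hdW) w ∧
      IsUnipM (n := n) ((U w ρ : GL (Fin (n + n)) ℂ) : Matrix (Fin (n + n)) (Fin (n + n)) ℂ) := by
    intro w ρ
    obtain ⟨u, hu, hU, hcoe⟩ := exists_archLocal_coe_eq_transl_loc L e dV hdV dW hdW T Tinv hT1 hT2 hTN w (conjTranspose_hermOfReal ρ)
    rw [← hUval w ρ] at hcoe
    rw [Units.ext hcoe.symm]
    exact ⟨hu, hU⟩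
  have hUcont : ∀ w, Continuous (U w) := fun w => by
    refine Units.continuous_iff.2 ⟨?_, ?_⟩
    · simp only [Function.comp_def, hUval]
      exact ((continuous_const.matrix_mul (Continuous.matrix_fromBlocks continuous_const continuous_hermOfReal continuous_const
        continuous_const)).matrix_mul continuous_const).matrix_reindex _ _
    · simp only [hUinv]
      exact ((continuous_const.matrix_mul (Continuous.matrix_fromBlocks continuous_const continuous_hermOfReal.neg continuous_const
        continuous_const)).matrix_mul continuous_const).matrix_reindex _ _
  -- the arch group element with prescribed local components lies in `N_Δ(L⁺ ⊗ ℝ)`; the inverse map `ψ` (kept opaque)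
  have hmemN : ∀ r : {w : InfinitePlace L // w.IsComplex} → (Fin n → Fin n → ℝ),
      (UnitaryGroup.archPiEquiv (Fp L) L (IsCMField.complexConj L) (n + n) (hermD L e dV hdV dW hdW) (IsCMField.complexConj_ne_one L)
        (UnitaryGroup.complexConj_smul_infinitePlace L)).symm (fun w => ⟨U w (r w), (hUmem w (r w)).1⟩) ∈ unipDeltaArch L e dV hdV dW hdW := by
    intro r
    rw [mem_unipDeltaArch_iff_forall_archAt]
    intro w
    rw [UnitaryGroup.archAt_archPiEquiv_symm]
    exact (hUmem w (r w)).2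
  obtain ⟨ψ, hψ⟩ : ∃ ψ : ({w : InfinitePlace L // w.IsComplex} → (Fin n → Fin n → ℝ)) → ↥(unipDeltaArch L e dV hdV dW hdW),
      ∀ r, (ψ r : UnitaryGroup.arch (Fp L) L (IsCMField.complexConj L) (n + n) (hermD L e dV hdV dW hdW)) =
        (UnitaryGroup.archPiEquiv (Fp L) L (IsCMField.complexConj L) (n + n) (hermD L e dV hdV dW hdW) (IsCMField.complexConj_ne_one L)
          (UnitaryGroup.complexConj_smul_infinitePlace L)).symm (fun w => ⟨U w (r w), (hUmem w (r w)).1⟩) :=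
    ⟨fun r => ⟨_, hmemN r⟩, fun _ => rfl⟩
  have hψcont : Continuous ψ := by
    refine Topology.IsInducing.subtypeVal.continuous_iff.2 ?_
    refine Continuous.congr ?_ (fun r => (hψ r).symm)
    refine (UnitaryGroup.archPiEquiv (Fp L) L (IsCMField.complexConj L) (n + n) (hermD L e dV hdV dW hdW) (IsCMField.complexConj_ne_one L)
      (UnitaryGroup.complexConj_smul_infinitePlace L)).symm.continuous.comp (continuous_pi fun w => ?_)
    refine Topology.IsInducing.subtypeVal.continuous_iff.2 ?_
    change Continuous fun r : {w : InfinitePlace L // w.IsComplex} → (Fin n → Fin n → ℝ) => U w (r w)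
    exact (hUcont w).comp (continuous_apply w)
  -- continuity of `a ↦ Fr a w`
  have hFrcont : ∀ w, Continuous fun a : UnitaryGroup.arch (Fp L) L (IsCMField.complexConj L) (n + n) (hermD L e dV hdV dW hdW) => Fr a w := by
    intro w
    have h : Continuous fun a : UnitaryGroup.arch (Fp L) L (IsCMField.complexConj L) (n + n) (hermD L e dV hdV dW hdW) =>
        T w * Matrix.reindex (e₂ (n := n)).symm (e₂ (n := n)).symm
          (((UnitaryGroup.archAt (Fp L) L (IsCMField.complexConj L) (n + n) (hermD L e dV hdV dW hdW) w
            (UnitaryGroup.complexConj_smul_infinitePlace L w.1) (IsCMField.complexConj_ne_one L) a :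
              UnitaryGroup.archLocal L (n + n) (hermD L e dV hdV dW hdW) w) : GL (Fin (n + n)) ℂ) : Matrix (Fin (n + n)) (Fin (n + n)) ℂ) * Tinv w :=
      (continuous_const.matrix_mul ((Units.continuous_val.comp (continuous_subtype_val.comp
        (UnitaryGroup.continuous_archAt (Fp L) L (IsCMField.complexConj L) (n + n) (hermD L e dV hdV dW hdW) w
          (UnitaryGroup.complexConj_smul_infinitePlace L w.1) (IsCMField.complexConj_ne_one L)))).matrix_reindex _ _)).matrix_mul continuous_const
    exact h.congr fun a => (hFr a w).symm
  have hφcont : Continuous φ := by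
    rw [hφdef]
    exact continuous_pi fun w => continuous_pi fun i => continuous_pi fun j =>
      (((continuous_re.comp (((hFrcont w).comp continuous_subtype_val).matrix_elem (Sum.inl i) (Sum.inr j))).add
        (continuous_im.comp (((hFrcont w).comp continuous_subtype_val).matrix_elem (Sum.inl i) (Sum.inr j)))).div_const _)
  -- the two inverse laws
  have hleft : ∀ u, ψ (φ u) = u := by
    intro u
    apply Subtype.ext
    rw [hψ, ContinuousMulEquiv.symm_apply_eq]
    funext w
    rw [UnitaryGroup.archPiEquiv_apply]
    apply Subtype.ext
    apply Units.ext
    have hX := eq_conj_of_frame_conj_eq L T Tinv hT2 w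
      ((hFr (u : UnitaryGroup.arch (Fp L) L (IsCMField.complexConj L) (n + n) (hermD L e dV hdV dW hdW)) w).symm.trans (hφ u w))
    change ((U w (φ u w) : GL (Fin (n + n)) ℂ) : Matrix (Fin (n + n)) (Fin (n + n)) ℂ) = _
    rw [hUval, ← hX, reindex_reindex_symm]
  have hright : ∀ r, φ (ψ r) = r := by
    intro r
    have hA : ∀ w, Fr (ψ r : UnitaryGroup.arch (Fp L) L (IsCMField.complexConj L) (n + n) (hermD L e dV hdV dW hdW)) w =
        fromBlocks 1 (hermOfReal (r w)) 0 1 := by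
      intro w
      rw [hψ, hFr, UnitaryGroup.archAt_archPiEquiv_symm]
      change T w * Matrix.reindex (e₂ (n := n)).symm (e₂ (n := n)).symm ((U w (r w) : GL (Fin (n + n)) ℂ) : Matrix (Fin (n + n)) (Fin (n + n)) ℂ) *
        Tinv w = _
      rw [hUval, reindex_symm_reindex', show T w * (Tinv w * fromBlocks 1 (hermOfReal (r w)) 0 1 * T w) * Tinv w =
        (T w * Tinv w) * fromBlocks 1 (hermOfReal (r w)) 0 1 * (T w * Tinv w) by simp only [Matrix.mul_assoc], hT1, Matrix.one_mul, Matrix.mul_one]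
    funext w i j
    rw [hφdef]
    dsimp only
    rw [hA, fromBlocks_apply₁₂, re_add_im_hermOfReal_div_two]
  refine ⟨{ toFun := φ
            invFun := ψ
            left_inv := hleft
            right_inv := hright
            continuous_toFun := hφcont
            continuous_invFun := hψcont }, fun u v => ?_, fun u w => ?_⟩
  · -- `Φ(uv) = Φ u + Φ v`: `Fr (uv) = Fr u · Fr v = n(B_u) n(B_v) = n(B_u + B_v)` and `hermOfReal` is injective
    change φ (u * v) = φ u + φ v
    funext w
    apply hermOfReal_injective
    have h := hφ (u * v) w
    rw [Subgroup.coe_mul, frame_mul L e dV hdV dW hdW T Tinv Fr hFr hT2, hφ u w, hφ v w, transl_mul_transl] at h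
    rw [Pi.add_apply, hermOfReal_add]
    exact (fromBlocks_inj.1 h).2.1.symm
  · -- the frame identity
    change Fr (u : UnitaryGroup.arch (Fp L) L (IsCMField.complexConj L) (n + n) (hermD L e dV hdV dW hdW)) w = fromBlocks 1 (hermOfReal (φ u w)) 0 1
    exact hφ u w

/-! ## §4  Haar transport through the frame -/

set_option synthInstance.maxSize 1024 in -- the nested-`pi` Haar instance `IsAddHaarMeasure (volume : Measure (σ → ℝ^{n×n}))` exceeds the default size 128
include hFr hT1 hT2 hTiv hTN in
/-- **HAAR TRANSPORT THROUGH THE FRAME (∀-Haar form).**  For every measure `ν` on `N_Δ(L⁺ ⊗ ℝ)` that is left-invariant and finite on compacts there is ONE constant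
`c : ℝ≥0` with `∫ Ψ(Fr u) dν(u) = c • ∫_{∏_w ℝ^{n×n}} Ψ((n(hermOfReal r_w))_w) dr` for EVERY `Ψ` on `∏_w M_{2n}(ℂ)` (§3 + ★ FILE 11 `exists_integral_comp_eq_smul`
with Lebesgue measure on `∏_w ℝ^{n×n}`). [Folland1995, §2.2] [BorelJacquet1979, §4.1] -/
theorem exists_integral_frame_eq_smul [Fintype {w : InfinitePlace L // w.IsComplex}] [MeasurableSpace ↥(unipDeltaArch L e dV hdV dW hdW)] [BorelSpace ↥(unipDeltaArch L e dV hdV dW hdW)]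
    (ν : Measure ↥(unipDeltaArch L e dV hdV dW hdW)) [IsFiniteMeasureOnCompacts ν] [ν.IsMulLeftInvariant]
    {F : Type*} [NormedAddCommGroup F] [NormedSpace ℝ F] :
    ∃ c : ℝ≥0, ∀ Ψ : ({w : InfinitePlace L // w.IsComplex} → Matrix (Fin n ⊕ Fin n) (Fin n ⊕ Fin n) ℂ) → F,
      ∫ u, Ψ (Fr (u : UnitaryGroup.arch (Fp L) L (IsCMField.complexConj L) (n + n) (hermD L e dV hdV dW hdW))) ∂ν =
        c • ∫ r : {w : InfinitePlace L // w.IsComplex} → (Fin n → Fin n → ℝ), Ψ (fun w => fromBlocks 1 (hermOfReal (r w)) 0 1) := by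
  obtain ⟨Φ, hΦ, hFrΦ⟩ := exists_frameCoordinates L e dV hdV dW hdW T Tinv Fr hFr hT1 hT2 hTiv hTN
  obtain ⟨c, hc⟩ := exists_integral_comp_eq_smul (volume : Measure ({w : InfinitePlace L // w.IsComplex} → (Fin n → Fin n → ℝ))) Φ hΦ ν (F := F)
  refine ⟨c, fun Ψ => ?_⟩
  have h : ∀ u : ↥(unipDeltaArch L e dV hdV dW hdW),
      Fr (u : UnitaryGroup.arch (Fp L) L (IsCMField.complexConj L) (n + n) (hermD L e dV hdV dW hdW)) = fun w => fromBlocks 1 (hermOfReal (Φ u w)) 0 1 :=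
    fun u => funext fun w => hFrΦ u w
  simp only [h]
  exact hc fun r => Ψ fun w => fromBlocks 1 (hermOfReal (r w)) 0 1

include hFr hT1 hT2 hTiv hTN in
/-- **HAAR TRANSPORT THROUGH THE FRAME, CONJUGATED FORM** — the shape of the arch block of ★ (E3): for fixed `x, g ∈ H_∞` (e.g. `x = (w_Δ)_∞`, `g = h_∞`),
`∫ Ψ(Fr (x u g)) dν(u) = c • ∫ Ψ((Fr x w · n(hermOfReal r_w) · Fr g w)_w) dr` for every `Ψ`, with the SAME constant `c` for all `x, g, Ψ` (★ `frame_mul`).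
[Folland1995, §2.2] [BorelJacquet1979, §4.1] -/
theorem exists_integral_frame_conj_eq_smul [Fintype {w : InfinitePlace L // w.IsComplex}] [MeasurableSpace ↥(unipDeltaArch L e dV hdV dW hdW)] [BorelSpace ↥(unipDeltaArch L e dV hdV dW hdW)]
    (ν : Measure ↥(unipDeltaArch L e dV hdV dW hdW)) [IsFiniteMeasureOnCompacts ν] [ν.IsMulLeftInvariant]
    {F : Type*} [NormedAddCommGroup F] [NormedSpace ℝ F] :
    ∃ c : ℝ≥0, ∀ (x g : UnitaryGroup.arch (Fp L) L (IsCMField.complexConj L) (n + n) (hermD L e dV hdV dW hdW))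
      (Ψ : ({w : InfinitePlace L // w.IsComplex} → Matrix (Fin n ⊕ Fin n) (Fin n ⊕ Fin n) ℂ) → F),
      ∫ u, Ψ (Fr (x * (u : UnitaryGroup.arch (Fp L) L (IsCMField.complexConj L) (n + n) (hermD L e dV hdV dW hdW)) * g)) ∂ν =
        c • ∫ r : {w : InfinitePlace L // w.IsComplex} → (Fin n → Fin n → ℝ), Ψ (fun w => Fr x w * fromBlocks 1 (hermOfReal (r w)) 0 1 * Fr g w) := by
  obtain ⟨c, hc⟩ := exists_integral_frame_eq_smul L e dV hdV dW hdW T Tinv Fr hFr hT1 hT2 hTiv hTN ν (F := F)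
  refine ⟨c, fun x g Ψ => ?_⟩
  have h : ∀ u : ↥(unipDeltaArch L e dV hdV dW hdW),
      Fr (x * (u : UnitaryGroup.arch (Fp L) L (IsCMField.complexConj L) (n + n) (hermD L e dV hdV dW hdW)) * g) =
        fun w => Fr x w * Fr (u : UnitaryGroup.arch (Fp L) L (IsCMField.complexConj L) (n + n) (hermD L e dV hdV dW hdW)) w * Fr g w :=
    fun u => funext fun w => by rw [frame_mul L e dV hdV dW hdW T Tinv Fr hFr hT2, frame_mul L e dV hdV dW hdW T Tinv Fr hFr hT2]
  simp only [h]
  exact hc fun m => Ψ fun w => Fr x w * m w * Fr g w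

end Adelic

end Summit.HodgeConjecture.HodgeConjecture.Cruxes.HLiu418.K2LiuArchUnipotentFrameCoordinates

end
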